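import Summits.ResolutionOfSingularities.ResolutionOfSingularities.Theorems.EquisingularLiftEquisingularLiftNatTowerConeRoundOldThree
import Summits.ResolutionOfSingularities.ResolutionOfSingularities.Theorems.EquisingularLiftEquisingularLiftNatTowerCechRoundThree
import Summits.ResolutionOfSingularities.ResolutionOfSingularities.Theorems.EquisingularLiftEquisingularLiftNatTowerCechRoundOldThree
import Summits.ResolutionOfSingularities.ResolutionOfSingularities.Theorems.EquisingularLiftEquisingularLiftNatTowerRuledConeRound
import Summits.ResolutionOfSingularities.ResolutionOfSingularities.Theorems.EquisingularLiftEquisingularLiftNatTowerSideFacts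
import HarnessLib

/-!
# [OURS · L1 W4.5(b) · EL♮(3)] HSUB′(ReachTower₄) — S6 `hCech` CLOSED MODULO (N1)/(N3)/(N3′)/S2 — the `Tower.Inv₃` (LOCALIZED SHADOW TRACE) twin of res-D-pv-057's
# …NatTowerCechRoundCloserV3 

res-L1-w45b-stub-4 g8 (res-D-pv-029's retarget list 2026-08-27T20:58:53Z; desk 21:48:43Z; TUO 21:54Z). OURS; NOT a statement of any manuscript;
AI-written, weaker than expert review. No `sorry`; standard axioms. DEF-FREE. `--supports stmt-ResolutionOfSingularities-20148 --as helper`.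

WHAT. res-D-pv-057's proof VERBATIM (credit: res-D-pv-057 g9) with: `Tower.Inv₂ ↦ Tower.Inv₃` in the `hCech` binder shape (= the S6 binder of
res-D-pv-018's v7 assembly); the round bricks ↦ `Tower.inv₃_cechRound_new/old`, `Tower.inv₃_coneRound_new[_sec]/old`,
`Tower.subset_closure_diff_of_inv₃_coneWitness`; the (N3)/(N3′) stand-ins `hShadow`/`hShadowOld` in the LOCAL currency of …NatTowerCechRoundThree
(input `∀ V, E ⊆ V → (𝒦·𝒪_G)|_V = 𝓘⟨closure K⟩|_V`, first output restricted to `υ₂⁻¹V`). Everything else unchanged.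
-/

set_option linter.dupNamespace false -- mandated namespace `Summit.<Summit>.<Problem>` of this single-conjunct summit
set_option linter.overlappingInstances false -- signatures carry `[IsDomain O] [IsDiscreteValuationRing O]`

noncomputable section

open CategoryTheory CategoryTheory.Limits AlgebraicGeometry TopologicalSpace Topology IsLocalRing
open Literature.AlgebraicGeometry.Resolution
open Literature.AlgebraicGeometry.Morphisms (ProjCech.PP ProjCech.toSpec)
open AlgebraicGeometry.Scheme.IdealSheafData
open Summit.ResolutionOfSingularities.ResolutionOfSingularities.Theses.EquisingularLift.Split
open Summit.ResolutionOfSingularities.ResolutionOfSingularities.Cruxes.EquisingularLift.StrataSplit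

namespace Summit.ResolutionOfSingularities.ResolutionOfSingularities.Cruxes.EquisingularLiftNat.Sections

set_option maxHeartbeats 1600000 in -- long binder texts; four case dispatches
/-- **S6 `hCech` of the assembly `hsub_reachTower_three_of`, closed modulo (N1) / (N3) / (N3′) / S2 — v2, dischargeable (N1)** (see the module docstring): the Čech-witnessed
round clause of HSUB′(ReachTower₃) at `INV₁ := Tower.Inv₂ ∧ (side facts)`, `Ruled := DirLift.Ruled`, for the whole `K′` menu of the driver.
[cite: GortzWedhorn2020, (13.19) and Prop. 13.91] [cite: Liu2002, Thm. 8.1.19] [OURS · L1 W4.5b] toward `stub_elnat_coneTowerPointResolution`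
(stmt-ResolutionOfSingularities-20148 / -20038); NOT a statement of the manuscript. -/
theorem Tower.hCech₃_of (O : Type) [CommRing O] [IsDomain O] [IsDiscreteValuationRing O] (k : Type) [Field k]
    (θ : O →+* k) (hθ : Function.Surjective θ)
    (P : Scheme.{0}) (q : P ⟶ Spec (.of O)) (hqprop : IsProper q) (Y : Set P) (hYirr : IsIrreducible Y) (hYcl : IsClosed Y)
    (hPnoeth : IsLocallyNoetherian P) (hPreg : Scheme.IsRegular P)
    (Ch : ∀ X' : Scheme.{0}, (X' ⟶ P) → Set X' → Prop)
    (hChain : ∀ (X' : Scheme.{0}) (σ : X' ⟶ P) (S : Set X'), Ch X' σ S → Chain P Y X' σ S)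
    (hStep : ∀ (X' X'' : Scheme.{0}) (σ' : X' ⟶ P) (S' : Set X') (C : X'.IdealSheafData) (τ : X'' ⟶ X'),
      Ch X' σ' S' → IsBlowup τ C → Scheme.IsRegular C.subscheme → Flat (C.subschemeι ≫ σ' ≫ q) →
      σ' '' (C.support : Set X') ⊆ {x : P | ¬ IsGenericPoint x Y} →
      (C.support : Set X') ∩ (σ' ≫ q) ⁻¹' {IsLocalRing.closedPoint O} ⊆ S' →
      Ch X'' (τ ≫ σ') (closure (τ ⁻¹' (S' \ (C.support : Set X')))))
    -- (N1) the Čech centre at every Čech-witnessed stage (v2: the round's data among the antecedents; = the conclusion of `Tower.hCentre_of_root`)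
    (hCentre : ∀ {F₉ : Scheme.{0}} (Z₉ : Set F₉) (hZ₉ : IsClosed Z₉) {F₁₀ : Scheme.{0}} (υ' : F₁₀ ⟶ F₉)
        (G : Scheme.{0}) (γ : G ⟶ F₁₀) (T E : Set G) (hE : IsClosed E) (Z : Set G) (hZ : IsClosed Z),
        Z ⊆ E ∩ T → Z.Nonempty → TowerFull F₉ F₁₀ υ' Z₉ hZ₉ G γ Z hZ → ¬ T ⊆ E →
        DirStepSec F₉ F₁₀ υ' Z₉ hZ₉ G γ Z hZ → RationalCarrier (redSub F₉ Z₉ hZ₉) →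
        (∀ x : redSub G Z hZ, IsRegularLocalRing (G.presheaf.stalk (redSubι G Z hZ x))) →
        (∀ (i : redSub G Z hZ ⟶ redSub G E hE), i ≫ redSubι G E hE = redSubι G Z hZ →
          ∀ x : redSub G Z hZ, IsRegularLocalRing ((redSub G E hE).presheaf.stalk (i x))) →
        DirStepUnobs G E hE Z hZ →
        ∀ (X : Scheme.{0}) (σ : X ⟶ P) (S : Set X) (jG : G ⟶ X) (tG : G ⟶ Spec (.of k)) (𝓔 : X.IdealSheafData),
        Ch X σ S → IsIntegral X → IsLocallyNoetherian X → Scheme.IsRegular X → IsDominant (σ ≫ q) →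
        IsPullback jG tG (σ ≫ q) (Spec.map (CommRingCat.ofHom θ)) → jG '' T = S →
        𝓔.comap jG = vanishingIdeal ⟨E, hE⟩ → (∀ z : X, (stalkIdeal 𝓔 z).IsPrincipal) → Scheme.IsRegular 𝓔.subscheme →
        σ '' (𝓔.support : Set X) ⊆ {p : P | ¬ IsGenericPoint p Y} →
        DirLift.Ruled O k θ P q Y F₉ Z₉ hZ₉ F₁₀ υ' G γ E X σ jG 𝓔 →
        ∃ 𝒦₁ : X.IdealSheafData,
          (𝓔 ⊔ 𝒦₁).comap jG = vanishingIdeal ⟨Z, hZ⟩ ∧ Flat ((𝓔 ⊔ 𝒦₁).subschemeι ≫ σ ≫ q) ∧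
          Scheme.IsRegular (𝓔 ⊔ 𝒦₁).subscheme ∧ IsEffectiveCartier (𝒦₁.comap 𝓔.subschemeι) ∧
          (∀ x ∈ (𝓔 ⊔ 𝒦₁).support, ∃ c : Fin 2 → X.presheaf.stalk x,
            Ideal.span (Set.range c) = stalkIdeal (𝓔 ⊔ 𝒦₁) x ∧ IsQuasiRegular c) ∧
          (RationalCarrier (redSub F₉ Z₉ hZ₉) →
            ∃ e₁ : (𝓔 ⊔ 𝒦₁).subscheme ≅ ProjCech.PP O 1, e₁.hom ≫ ProjCech.toSpec O 1 = (𝓔 ⊔ 𝒦₁).subschemeι ≫ σ ≫ q))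
    -- (N3) the transported shadow next to the NEW surface, off the shadow
    (hShadow : ∀ {F₉ : Scheme.{0}} (Z₉ : Set F₉) (hZ₉ : IsClosed Z₉) {F₁₀ : Scheme.{0}} (υ' : F₁₀ ⟶ F₉)
        (G G' : Scheme.{0}) (γ : G ⟶ F₁₀) (T E K : Set G) (hE : IsClosed E) (Z : Set G) (hZ : IsClosed Z) (υ₂ : G' ⟶ G),
        DirStepSec F₉ F₁₀ υ' Z₉ hZ₉ G γ Z hZ → IsBlowup υ₂ (vanishingIdeal ⟨Z, hZ⟩) →
        ∀ (X : Scheme.{0}) (σ : X ⟶ P) (S : Set X) (jG : G ⟶ X) (tG : G ⟶ Spec (.of k)) (𝓔 𝒦 𝒦₁ : X.IdealSheafData)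
        (X₂ : Scheme.{0}) (τ : X₂ ⟶ X) (j₂ : G' ⟶ X₂) (t₂ : G' ⟶ Spec (.of k)),
        Ch X σ S → IsIntegral X → IsLocallyNoetherian X → Scheme.IsRegular X → IsDominant (σ ≫ q) →
        IsPullback jG tG (σ ≫ q) (Spec.map (CommRingCat.ofHom θ)) → jG '' T = S →
        𝓔.comap jG = vanishingIdeal ⟨E, hE⟩ → (∀ z : X, (stalkIdeal 𝓔 z).IsPrincipal) → Scheme.IsRegular 𝓔.subscheme →
        (∀ z : X, (stalkIdeal 𝒦 z).IsPrincipal) → ∀ (V : G.Opens), E ⊆ (V : Set G) →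
        (𝒦.comap jG).comap V.ι = (vanishingIdeal (⟨closure K, isClosed_closure⟩ : Closeds G)).comap V.ι →
        Flat ((𝓔 ⊔ 𝒦).subschemeι ≫ σ ≫ q) → IsEffectiveCartier (𝓔.comap 𝒦.subschemeι) → IsEffectiveCartier (𝒦.comap 𝓔.subschemeι) →
        (𝓔 ⊔ 𝒦₁).comap jG = vanishingIdeal ⟨Z, hZ⟩ → Flat ((𝓔 ⊔ 𝒦₁).subschemeι ≫ σ ≫ q) → Scheme.IsRegular (𝓔 ⊔ 𝒦₁).subscheme →
        IsEffectiveCartier (𝒦₁.comap 𝓔.subschemeι) →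
        IsBlowup τ (𝓔 ⊔ 𝒦₁) → IsPullback j₂ t₂ ((τ ≫ σ) ≫ q) (Spec.map (CommRingCat.ofHom θ)) → j₂ ≫ τ = υ₂ ≫ jG →
        IsClosed K → K ⊆ closure (K \ E) → K ≠ Set.univ → closure (Z \ closure K) = Z →
        ((strictTransformIdeal τ (𝓔 ⊔ 𝒦₁) 𝒦).comap j₂).comap (υ₂ ⁻¹ᵁ V).ι =
            (vanishingIdeal (⟨closure (closure (υ₂ ⁻¹' (K \ Z))), isClosed_closure⟩ : Closeds G')).comap (υ₂ ⁻¹ᵁ V).ι ∧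
          Flat ((((𝓔 ⊔ 𝒦₁).comap τ) ⊔ strictTransformIdeal τ (𝓔 ⊔ 𝒦₁) 𝒦).subschemeι ≫ (τ ≫ σ) ≫ q) ∧
          (∀ (hE' : IsClosed (υ₂ ⁻¹' Z)) (y : G'),
            j₂ y ∈ ((((𝓔 ⊔ 𝒦₁).comap τ) ⊔ strictTransformIdeal τ (𝓔 ⊔ 𝒦₁) 𝒦).support : Set X₂) →
            stalkIdeal (vanishingIdeal (⟨υ₂ ⁻¹' Z, hE'⟩ : Closeds G') ⊔
              vanishingIdeal (⟨closure (closure (υ₂ ⁻¹' (K \ Z))), isClosed_closure⟩ : Closeds G')) y =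
            stalkIdeal (vanishingIdeal (⟨υ₂ ⁻¹' Z ∩ closure (closure (υ₂ ⁻¹' (K \ Z))), hE'.inter isClosed_closure⟩ : Closeds G')) y →
            IsRegularLocalRing (X₂.presheaf.stalk (j₂ y) ⧸
              stalkIdeal (((𝓔 ⊔ 𝒦₁).comap τ) ⊔ strictTransformIdeal τ (𝓔 ⊔ 𝒦₁) 𝒦) (j₂ y))) ∧
          IsEffectiveCartier (((𝓔 ⊔ 𝒦₁).comap τ).comap (strictTransformIdeal τ (𝓔 ⊔ 𝒦₁) 𝒦).subschemeι) ∧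
          IsEffectiveCartier ((strictTransformIdeal τ (𝓔 ⊔ 𝒦₁) 𝒦).comap ((𝓔 ⊔ 𝒦₁).comap τ).subschemeι))
    -- (N3′) the transported shadow next to the OLD surface, off the shadow
    (hShadowOld : ∀ {F₉ : Scheme.{0}} (Z₉ : Set F₉) (hZ₉ : IsClosed Z₉) {F₁₀ : Scheme.{0}} (υ' : F₁₀ ⟶ F₉)
        (G G' : Scheme.{0}) (γ : G ⟶ F₁₀) (T E K : Set G) (hE : IsClosed E) (Z : Set G) (hZ : IsClosed Z) (υ₂ : G' ⟶ G),
        DirStepSec F₉ F₁₀ υ' Z₉ hZ₉ G γ Z hZ → IsBlowup υ₂ (vanishingIdeal ⟨Z, hZ⟩) →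
        ∀ (X : Scheme.{0}) (σ : X ⟶ P) (S : Set X) (jG : G ⟶ X) (tG : G ⟶ Spec (.of k)) (𝓔 𝒦 𝒦₁ : X.IdealSheafData)
        (X₂ : Scheme.{0}) (τ : X₂ ⟶ X) (j₂ : G' ⟶ X₂) (t₂ : G' ⟶ Spec (.of k)),
        Ch X σ S → IsIntegral X → IsLocallyNoetherian X → Scheme.IsRegular X → IsDominant (σ ≫ q) →
        IsPullback jG tG (σ ≫ q) (Spec.map (CommRingCat.ofHom θ)) → jG '' T = S →
        𝓔.comap jG = vanishingIdeal ⟨E, hE⟩ → (∀ z : X, (stalkIdeal 𝓔 z).IsPrincipal) → Scheme.IsRegular 𝓔.subscheme →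
        (∀ z : X, (stalkIdeal 𝒦 z).IsPrincipal) → ∀ (V : G.Opens), E ⊆ (V : Set G) →
        (𝒦.comap jG).comap V.ι = (vanishingIdeal (⟨closure K, isClosed_closure⟩ : Closeds G)).comap V.ι →
        Flat ((𝓔 ⊔ 𝒦).subschemeι ≫ σ ≫ q) → IsEffectiveCartier (𝓔.comap 𝒦.subschemeι) → IsEffectiveCartier (𝒦.comap 𝓔.subschemeι) →
        (𝓔 ⊔ 𝒦₁).comap jG = vanishingIdeal ⟨Z, hZ⟩ → Flat ((𝓔 ⊔ 𝒦₁).subschemeι ≫ σ ≫ q) → Scheme.IsRegular (𝓔 ⊔ 𝒦₁).subscheme →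
        IsEffectiveCartier (𝒦₁.comap 𝓔.subschemeι) →
        IsBlowup τ (𝓔 ⊔ 𝒦₁) → IsPullback j₂ t₂ ((τ ≫ σ) ≫ q) (Spec.map (CommRingCat.ofHom θ)) → j₂ ≫ τ = υ₂ ≫ jG →
        IsClosed K → K ⊆ closure (K \ E) → K ≠ Set.univ → closure (Z \ closure K) = Z →
        ((strictTransformIdeal τ (𝓔 ⊔ 𝒦₁) 𝒦).comap j₂).comap (υ₂ ⁻¹ᵁ V).ι =
            (vanishingIdeal (⟨closure (closure (υ₂ ⁻¹' (K \ Z))), isClosed_closure⟩ : Closeds G')).comap (υ₂ ⁻¹ᵁ V).ι ∧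
          Flat ((strictTransformIdeal τ (𝓔 ⊔ 𝒦₁) 𝓔 ⊔ strictTransformIdeal τ (𝓔 ⊔ 𝒦₁) 𝒦).subschemeι ≫ (τ ≫ σ) ≫ q) ∧
          (∀ (hE' : IsClosed (closure (υ₂ ⁻¹' (E \ Z)))) (y : G'),
            j₂ y ∈ ((strictTransformIdeal τ (𝓔 ⊔ 𝒦₁) 𝓔 ⊔ strictTransformIdeal τ (𝓔 ⊔ 𝒦₁) 𝒦).support : Set X₂) →
            stalkIdeal (vanishingIdeal (⟨closure (υ₂ ⁻¹' (E \ Z)), hE'⟩ : Closeds G') ⊔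
              vanishingIdeal (⟨closure (closure (υ₂ ⁻¹' (K \ Z))), isClosed_closure⟩ : Closeds G')) y =
            stalkIdeal (vanishingIdeal (⟨closure (υ₂ ⁻¹' (E \ Z)) ∩ closure (closure (υ₂ ⁻¹' (K \ Z))), hE'.inter isClosed_closure⟩ :
              Closeds G')) y →
            IsRegularLocalRing (X₂.presheaf.stalk (j₂ y) ⧸
              stalkIdeal (strictTransformIdeal τ (𝓔 ⊔ 𝒦₁) 𝓔 ⊔ strictTransformIdeal τ (𝓔 ⊔ 𝒦₁) 𝒦) (j₂ y))) ∧
          IsEffectiveCartier ((strictTransformIdeal τ (𝓔 ⊔ 𝒦₁) 𝓔).comap (strictTransformIdeal τ (𝓔 ⊔ 𝒦₁) 𝒦).subschemeι) ∧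
          IsEffectiveCartier ((strictTransformIdeal τ (𝓔 ⊔ 𝒦₁) 𝒦).comap (strictTransformIdeal τ (𝓔 ⊔ 𝒦₁) 𝓔).subschemeι))
    -- S2 the assembly's own stand-in (ruled-surface datum born at a CONE round), for the cone-witnessed sub-case
    (hRootRound : ∀ {F₉ : Scheme.{0}} (Z₉ : Set F₉) (hZ₉ : IsClosed Z₉) {F₁₀ : Scheme.{0}} (υ' : F₁₀ ⟶ F₉)
        (G G' : Scheme.{0}) (γ : G ⟶ F₁₀) (T : Set G) (Z : Set G) (hZ : IsClosed Z) (υ₂ : G' ⟶ G)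
        (X : Scheme.{0}) (σ : X ⟶ P) (S : Set X) (jG : G ⟶ X) (tG : G ⟶ Spec (.of k)) (𝓔 𝒦 : X.IdealSheafData)
        (X'' : Scheme.{0}) (τ : X'' ⟶ X) (j₂ : G' ⟶ X'') (t₂ : G' ⟶ Spec (.of k)),
        Ch X σ S → IsIntegral X → IsLocallyNoetherian X → Scheme.IsRegular X → IsDominant (σ ≫ q) →
        IsPullback jG tG (σ ≫ q) (Spec.map (CommRingCat.ofHom θ)) → jG '' T = S →
        (𝓔 ⊔ 𝒦).comap jG = vanishingIdeal ⟨Z, hZ⟩ → Flat ((𝓔 ⊔ 𝒦).subschemeι ≫ σ ≫ q) → Scheme.IsRegular (𝓔 ⊔ 𝒦).subscheme →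
        Scheme.IsRegular 𝓔.subscheme → IsBlowup τ (𝓔 ⊔ 𝒦) → IsPullback j₂ t₂ ((τ ≫ σ) ≫ q) (Spec.map (CommRingCat.ofHom θ)) →
        j₂ ≫ τ = υ₂ ≫ jG →
        DirLift.Ruled O k θ P q Y F₉ Z₉ hZ₉ F₁₀ υ' G' (υ₂ ≫ γ) (υ₂ ⁻¹' Z) X'' (τ ≫ σ) j₂ ((𝓔 ⊔ 𝒦).comap τ)) :
    -- ======== the `hCech` binder of `hsub_reachTower_three_of`, VERBATIM ========
    ∀ {F₉ : Scheme.{0}} (Z₉ : Set F₉) (hZ₉ : IsClosed Z₉) {F₁₀ : Scheme.{0}} (υ' : F₁₀ ⟶ F₉)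
        (G G' : Scheme.{0}) (γ : G ⟶ F₁₀) (T E K : Set G) (hE : IsClosed E) (Z : Set G) (hZ : IsClosed Z) (υ₂ : G' ⟶ G) (K' : Set G'),
        (Tower.Inv₃ O k θ P q Y Ch (DirLift.Ruled O k θ P q Y) F₉ Z₉ hZ₉ F₁₀ υ' G γ T E K ∧ IsClosed K ∧ K ⊆ closure (K \ E) ∧ K ≠ Set.univ) →
        Z ⊆ E ∩ T → Z.Nonempty → TowerFull F₉ F₁₀ υ' Z₉ hZ₉ G γ Z hZ →
        (DirStepSec F₉ F₁₀ υ' Z₉ hZ₉ G γ Z hZ ∧ RationalCarrier (redSub F₉ Z₉ hZ₉) ∧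
          (∀ x : redSub G Z hZ, IsRegularLocalRing (G.presheaf.stalk (redSubι G Z hZ x))) ∧
          (∀ (i : redSub G Z hZ ⟶ redSub G E hE), i ≫ redSubι G E hE = redSubι G Z hZ →
            ∀ x : redSub G Z hZ, IsRegularLocalRing ((redSub G E hE).presheaf.stalk (i x))) ∧ DirStepUnobs G E hE Z hZ) →
        IsBlowup υ₂ (vanishingIdeal (⟨Z, hZ⟩ : Closeds G)) →
        (K' = ∅ ∨ ((ConeWitness G E hE K Z hZ ∨ closure (Z \ closure K) = Z) ∧ K' = closure (υ₂ ⁻¹' (K \ Z)))) →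
        (Tower.Inv₃ O k θ P q Y Ch (DirLift.Ruled O k θ P q Y) F₉ Z₉ hZ₉ F₁₀ υ' G' (υ₂ ≫ γ) (closure (υ₂ ⁻¹' (T \ Z))) (υ₂ ⁻¹' Z) K' ∧
            IsClosed K' ∧ K' ⊆ closure (K' \ υ₂ ⁻¹' Z) ∧ K' ≠ Set.univ) ∧
          (Tower.Inv₃ O k θ P q Y Ch (DirLift.Ruled O k θ P q Y) F₉ Z₉ hZ₉ F₁₀ υ' G' (υ₂ ≫ γ) (closure (υ₂ ⁻¹' (T \ Z))) (closure (υ₂ ⁻¹' (E \ Z))) K' ∧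
            IsClosed K' ∧ K' ⊆ closure (K' \ closure (υ₂ ⁻¹' (E \ Z))) ∧ K' ≠ Set.univ) := by
  intro F₉ Z₉ hZ₉ F₁₀ υ' G G' γ T E K hE Z hZ υ₂ K' hI hZET hZne hfull hwit hυ₂ hK'
  haveI := hqprop
  obtain ⟨hinv, hKcl, hKE, hKne⟩ := hI
  obtain ⟨hsec, hrat, hGreg, hEreg, hunobs⟩ := hwit
  have hGint : IsIntegral G := hinv.2.2.1
  have hEcl : IsClosed E := hinv.2.2.2.2.2.1
  have hTE : ¬ T ⊆ E := hinv.2.2.2.2.2.2.1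
  haveI := hGint
  have hZE : Z ⊆ E := fun z hz => (hZET hz).1
  have hTZ : ¬ T ⊆ Z := fun h => hTE (h.trans hZE)
  have hZsupp : ((vanishingIdeal (⟨Z, hZ⟩ : Closeds G) : G.IdealSheafData).support : Set G) = Z :=
    Scheme.IdealSheafData.coe_support_vanishingIdeal _
  -- the two `Tower.Inv₂` conclusions, for the three admitted shapes of `K′`
  have hboth : Tower.Inv₃ O k θ P q Y Ch (DirLift.Ruled O k θ P q Y) F₉ Z₉ hZ₉ F₁₀ υ' G' (υ₂ ≫ γ) (closure (υ₂ ⁻¹' (T \ Z))) (υ₂ ⁻¹' Z) K' ∧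
      Tower.Inv₃ O k θ P q Y Ch (DirLift.Ruled O k θ P q Y) F₉ Z₉ hZ₉ F₁₀ υ' G' (υ₂ ≫ γ) (closure (υ₂ ⁻¹' (T \ Z)))
        (closure (υ₂ ⁻¹' (E \ Z))) K' := by
    -- the Čech centre at this stage, (N1) fed with the witness
    have hC := hCentre Z₉ hZ₉ υ' G γ T E hE Z hZ hZET hZne hfull hTE hsec hrat hGreg hEreg hunobs
    have hS := hShadow Z₉ hZ₉ υ' G G' γ T E K hE Z hZ υ₂ hsec hυ₂
    have hSo := hShadowOld Z₉ hZ₉ υ' G G' γ T E K hE Z hZ υ₂ hsec hυ₂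
    rcases hK' with hK0 | ⟨hcase, hKst⟩
    · exact ⟨Tower.inv₃_cechRound_new O k θ hθ P q Y hYirr hYcl hPnoeth hPreg Ch hChain hStep Z₉ hZ₉ υ' G G' γ T E K hE Z hZ υ₂ hinv hZET hfull
          hsec hυ₂ hKcl hKE hKne hC hS K' (Or.inl hK0),
        Tower.inv₃_cechRound_old O k θ hθ P q Y hYirr hYcl hPnoeth hPreg Ch hChain hStep Z₉ hZ₉ υ' G G' γ T E K hE Z hZ υ₂ hinv hZET hfull
          hυ₂ hKcl hKE hKne hC hSo K' (Or.inl hK0)⟩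
    · rcases hcase with hcone | hoff
      · -- cone-witnessed as well: res-D-pv-029's cone-round bricks (stand-ins discharged by stub-2's S4/S5, S2 passed through)
        have hK'' : K' = ∅ ∨ K' = closure (υ₂ ⁻¹' (K \ Z)) := Or.inr hKst
        exact ⟨Tower.inv₃_coneRound_new O k θ hθ P q Y hYirr hYcl hPnoeth hPreg Ch hChain hStep (DirLift.Ruled O k θ P q Y) Z₉ hZ₉ υ' G G' γ
            T E K hE Z hZ υ₂ hinv hZET hZne hfull hcone hυ₂ hKcl hKE hKne (hRootRound Z₉ hZ₉ υ' G G' γ T Z hZ υ₂) K' hK'',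
          Tower.inv₃_coneRound_old O k θ hθ P q Y hYirr hYcl hPnoeth hPreg Ch hChain hStep (DirLift.Ruled O k θ P q Y) Z₉ hZ₉ υ' G G' γ
            T E K hE Z hZ υ₂ hinv hZET hZne hfull hcone hυ₂ hKcl hKE
            (Tower.subset_closure_diff_of_inv₃_coneWitness O k θ hθ P q Y Ch (DirLift.Ruled O k θ P q Y) Z₉ hZ₉ υ' G γ T E K hE Z hZ hinv hfull hZE hcone)
            (fun X σ jG 𝓔 𝒦 X'' τ j₂ t₂ _ _ hcomm _ he h => by
              obtain ⟨e, he⟩ := he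
              exact DirLift.ruled_comp h τ υ₂ j₂ hcomm _ e he _) K' hK''⟩
      · exact ⟨Tower.inv₃_cechRound_new O k θ hθ P q Y hYirr hYcl hPnoeth hPreg Ch hChain hStep Z₉ hZ₉ υ' G G' γ T E K hE Z hZ υ₂ hinv hZET hfull
            hsec hυ₂ hKcl hKE hKne hC hS K' (Or.inr ⟨hoff, hKst⟩),
          Tower.inv₃_cechRound_old O k θ hθ P q Y hYirr hYcl hPnoeth hPreg Ch hChain hStep Z₉ hZ₉ υ' G G' γ T E K hE Z hZ υ₂ hinv hZET hfull
            hυ₂ hKcl hKE hKne hC hSo K' (Or.inr ⟨hoff, hKst⟩)⟩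
  obtain ⟨hnew, hold⟩ := hboth
  have hG'int : IsIntegral G' := hnew.2.2.1
  haveI := hG'int
  -- the downstairs side facts of `K′` (res-D-pv-029's …NatTowerSideFacts)
  rcases hK' with rfl | ⟨-, rfl⟩
  · exact ⟨⟨hnew, isClosed_empty, Set.empty_subset _, Set.empty_ne_univ⟩, ⟨hold, isClosed_empty, Set.empty_subset _, Set.empty_ne_univ⟩⟩
  · have hne : closure (υ₂ ⁻¹' (K \ Z)) ≠ Set.univ :=
      closure_preimage_ne_univ υ₂ _ hυ₂ K Z hKcl hKne hZ (fun h => hTZ (h ▸ Set.subset_univ _)) hZsupp.le _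
        (Set.preimage_mono fun z hz => hz.1)
    refine ⟨⟨hnew, isClosed_closure, closure_preimage_diff_subset_closure_diff_preimage υ₂ K Z, hne⟩,
      ⟨hold, isClosed_closure, ?_, hne⟩⟩
    have h := closure_preimage_diff_subset_of_isBlowup υ₂ (vanishingIdeal (⟨Z, hZ⟩ : Closeds G)) hυ₂ K E hEcl hKE
    rw [hZsupp] at h
    exact h



end Summit.ResolutionOfSingularities.ResolutionOfSingularities.Cruxes.EquisingularLiftNat.Sections

end
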